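import Summits.Ventures.WeilGRH.TwistedFlatTest
import HarnessLib

/-!
# GRH arm (rh-explicit, venture WeilGRH): the REAL-WINDOW family — every real window function gives a
  linear key inequality from a `χ`-rung (autocorrelation profiles as normal vectors)

Cell `rh-explicit`, WEIL TRACK (structure seat weil-3, gen7) for the GRH ARM.  Generalises `TwistedFlatTest.lean`
(the flat window `χ_0`) to an ARBITRARY real window function `r` on `[-a, a]` (bounded, measurable, vanishing off
the window; smooth inside for the rung step).  With `N = ‖r‖₂²`, the autocorrelation
`A_r(t) = ∫ r(x+t) r(x) dx` (`weilIncrement_ofReal_eq_sub_autocorr`: `D_t(r) = 2N − 2A_r(t)`) and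
`weilTwistIncrement_ofReal_fun` (`D^ω_t(r) = ‖1−ω‖²N + Re ω·D_t(r)`), the twisted window form of `r` is
(`twistedWindowForm_ofReal`)

  `𝓔^χ_a(r) − M^χ_a N = log q · N − [2Σ_{log n<2a} Λ(n)n^{-1/2} Re χ(n) A_r(log n) + K_κ N − ∫₀^∞ρ_κ(t) D_t(r) dt]`,

so (`realWindow_le_log_of_weilPositivityOnChar`) for every `χ` mod `q ≠ 1`, `a > 0` and every such `r ≠ 0`:

  `WeilPositivityOnChar χ a ⟹ 2Σ_{log n<2a} Λ(n)n^{-1/2}·[A_r(log n)/N]·Re χ(n) + K_κ − (1/N)∫₀^∞ρ_κ D_t(r) ≤ log q`.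

Each real window is a supporting half-space of the rung's key set whose normal vector is the sampled
autocorrelation profile `(Λ(n)n^{-1/2}A_r(log n)/N)_n` (`|A_r/N| ≤ 1`); the flat window (`A/N = (1 − t/2a)₊`) is
`TwistedFlatTest.flatWindow_le_log_of_weilPositivityOnChar`, and the optimal profile for the trivial key is the
`cosh(x/2)`-window (`A/N ≈ e^{-t/2}`-weighted, giving the transfer constant `2(sinh a + a)` asymptotically).
RH/GRH-free; no definitions, no named facts.
-/

set_option autoImplicit false

noncomputable section

open Complex Filter Set MeasureTheory
open scoped Real Topology ComplexConjugate ContDiff ArithmeticFunction.vonMangoldt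

namespace Summit.Ventures.WeilGRH

open Literature.NumberTheory.LFunctions
open Summit.RiemannHypothesis.RiemannHypothesis.Theorems.WeilFormatC

variable {q : ℕ} {a S : ℝ} {r : ℝ → ℝ}

/-! ## Increments of a real window through its autocorrelation -/

/-- **`D_t(r) = 2‖r‖₂² − 2A_r(t)`** for a real bounded measurable `r` vanishing off `[-a,a]`, with the
autocorrelation `A_r(t) = ∫ r(x+t) r(x) dx` (and the integrability of `x ↦ r(x+t) r(x)`). -/
theorem weilIncrement_ofReal_eq_sub_autocorr (hm : Measurable r) (hz : ∀ x, x ∉ Icc (-a) a → r x = 0)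
    (hb : ∀ x, |r x| ≤ S) (t : ℝ) :
    Integrable (fun x ↦ r (x + t) * r x) ∧
      weilIncrement (fun x ↦ (r x : ℂ)) t = 2 * (∫ x, ‖(r x : ℂ)‖ ^ 2) - 2 * ∫ x, r (x + t) * r x := by
  have hmu : Measurable (fun x ↦ (r x : ℂ)) := Complex.measurable_ofReal.comp hm
  have hzu : ∀ x, x ∉ Icc (-a) a → (fun x ↦ (r x : ℂ)) x = 0 := fun x hx ↦ by
    simp only [hz x hx, Complex.ofReal_zero]
  have hbu : ∀ x, ‖(fun x ↦ (r x : ℂ)) x‖ ≤ S := fun x ↦ by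
    simp only [Complex.norm_real, Real.norm_eq_abs]; exact hb x
  have hN : Integrable fun x ↦ ‖(r x : ℂ)‖ ^ 2 := integrable_norm_sq_window hmu hzu hbu
  have hNt : Integrable fun x ↦ ‖(r (x + t) : ℂ)‖ ^ 2 := hN.comp_add_right t
  have hD : Integrable fun x ↦ ‖(r (x + t) : ℂ) - (r x : ℂ)‖ ^ 2 :=
    integrable_norm_sub_sq_window hmu hzu hbu t
  have e2 : ∀ y, ‖(r y : ℂ)‖ ^ 2 = r y ^ 2 := fun y ↦ by
    rw [Complex.norm_real, Real.norm_eq_abs, sq_abs]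
  have e3 : ∀ x, ‖(r (x + t) : ℂ) - (r x : ℂ)‖ ^ 2 = (r (x + t) - r x) ^ 2 := fun x ↦ by
    rw [← Complex.ofReal_sub, Complex.norm_real, Real.norm_eq_abs, sq_abs]
  -- the cross term as a combination of integrable squares
  have hpt : ∀ x, r (x + t) * r x =
      (1 / 2) * ‖(r (x + t) : ℂ)‖ ^ 2 + (1 / 2) * ‖(r x : ℂ)‖ ^ 2 -
        (1 / 2) * ‖(r (x + t) : ℂ) - (r x : ℂ)‖ ^ 2 := by
    intro x; rw [e2, e2, e3]; ring
  have hA : Integrable (fun x ↦ r (x + t) * r x) := by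
    have : (fun x ↦ r (x + t) * r x) = fun x ↦ (1 / 2) * ‖(r (x + t) : ℂ)‖ ^ 2 +
        (1 / 2) * ‖(r x : ℂ)‖ ^ 2 - (1 / 2) * ‖(r (x + t) : ℂ) - (r x : ℂ)‖ ^ 2 := funext hpt
    rw [this]
    exact ((hNt.const_mul _).add (hN.const_mul _)).sub (hD.const_mul _)
  refine ⟨hA, ?_⟩
  have hshift : ∫ x, ‖(r (x + t) : ℂ)‖ ^ 2 = ∫ x, ‖(r x : ℂ)‖ ^ 2 :=
    integral_add_right_eq_self (fun x ↦ ‖(r x : ℂ)‖ ^ 2) t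
  have hcross : ∫ x, r (x + t) * r x =
      (1 / 2) * (∫ x, ‖(r (x + t) : ℂ)‖ ^ 2) + (1 / 2) * (∫ x, ‖(r x : ℂ)‖ ^ 2) -
        (1 / 2) * ∫ x, ‖(r (x + t) : ℂ) - (r x : ℂ)‖ ^ 2 := by
    have h12 : Integrable (fun x ↦ (1 / 2) * ‖(r (x + t) : ℂ)‖ ^ 2 + (1 / 2) * ‖(r x : ℂ)‖ ^ 2) :=
      (hNt.const_mul _).add (hN.const_mul _)
    rw [integral_congr_ae (Eventually.of_forall hpt)]
    rw [integral_sub h12 (hD.const_mul _),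
      integral_add (hNt.const_mul _) (hN.const_mul _), integral_const_mul, integral_const_mul,
      integral_const_mul]
  unfold weilIncrement
  rw [hcross, hshift]
  ring

/-! ## The twisted window form of a real window -/

/-- **THE TWISTED WINDOW FORM OF A REAL WINDOW FUNCTION** (`χ` mod `q`, parity `κ`; `r` real bounded
measurable vanishing off `[-a, a]`, `N = ‖r‖₂²`, `A_r(t) = ∫ r(x+t)r(x)dx`):
`𝓔^χ_a(r) − M^χ_a N = log q·N − [2Σ_{log n<2a}Λ(n)n^{-1/2} Re χ(n) A_r(log n) + K_κ N − ∫₀^∞ ρ_κ D_t(r)]`. -/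
theorem twistedWindowForm_ofReal (χ : DirichletCharacter ℂ q) (hm : Measurable r)
    (hz : ∀ x, x ∉ Icc (-a) a → r x = 0) (hb : ∀ x, |r x| ≤ S) :
    weilDirichletEnergyChar χ a (fun x ↦ (r x : ℂ)) -
        weilMarkovConstantChar χ a * ∫ x, ‖(r x : ℂ)‖ ^ 2 =
      Real.log q * (∫ x, ‖(r x : ℂ)‖ ^ 2) -
        (2 * (∑ n ∈ weilPrimeIndex a,
            (Λ n : ℝ) / Real.sqrt n * ((χ (n : ZMod q)).re * ∫ x, r (x + Real.log n) * r x)) +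
          (Real.log (4 * π) + Real.eulerMascheroniConstant +
            2 * ∫ t in Ioi (0 : ℝ), weilKillingDensityPar (charParity χ) t) * (∫ x, ‖(r x : ℂ)‖ ^ 2) -
          ∫ t in Ioi (0 : ℝ), weilArchDensityPar (charParity χ) t * weilIncrement (fun x ↦ (r x : ℂ)) t) := by
  set N : ℝ := ∫ x, ‖(r x : ℂ)‖ ^ 2 with hN
  unfold weilDirichletEnergyChar weilMarkovConstantChar
  have hprime : ∑ n ∈ weilPrimeIndex a, (Λ n : ℝ) / Real.sqrt n *
        weilTwistIncrement (conj (χ (n : ZMod q))) (fun x ↦ (r x : ℂ)) (Real.log n) =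
      ∑ n ∈ weilPrimeIndex a, (Λ n : ℝ) / Real.sqrt n *
        (‖1 - conj (χ (n : ZMod q))‖ ^ 2 * N + (χ (n : ZMod q)).re *
          (2 * N - 2 * ∫ x, r (x + Real.log n) * r x)) := by
    refine Finset.sum_congr rfl fun n _ ↦ ?_
    rw [weilTwistIncrement_ofReal_fun hm hz hb, (weilIncrement_ofReal_eq_sub_autocorr hm hz hb _).2,
      Complex.conj_re]
  rw [hprime]
  have key : ∀ z : ℂ, ‖1 - conj z‖ ^ 2 + 2 * z.re - (1 + ‖z‖ ^ 2) = 0 := fun z ↦ by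
    rw [Complex.sq_norm, Complex.sq_norm, Complex.normSq_apply, Complex.normSq_apply]
    simp only [Complex.sub_re, Complex.one_re, Complex.conj_re, Complex.sub_im, Complex.one_im,
      Complex.conj_im, sub_neg_eq_add]
    ring
  have hsum : (∑ n ∈ weilPrimeIndex a, (Λ n : ℝ) / Real.sqrt n *
        (‖1 - conj (χ (n : ZMod q))‖ ^ 2 * N + (χ (n : ZMod q)).re *
          (2 * N - 2 * ∫ x, r (x + Real.log n) * r x))) -
      (∑ n ∈ weilPrimeIndex a, (Λ n : ℝ) / Real.sqrt n * (1 + ‖χ (n : ZMod q)‖ ^ 2)) * N =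
      -(2 * ∑ n ∈ weilPrimeIndex a,
          (Λ n : ℝ) / Real.sqrt n * ((χ (n : ZMod q)).re * ∫ x, r (x + Real.log n) * r x)) := by
    rw [Finset.sum_mul, ← Finset.sum_sub_distrib, Finset.mul_sum, ← Finset.sum_neg_distrib]
    refine Finset.sum_congr rfl fun n _ ↦ ?_
    have hk := key (χ (n : ZMod q))
    have : (Λ n : ℝ) / Real.sqrt n *
        (‖1 - conj (χ (n : ZMod q))‖ ^ 2 * N + (χ (n : ZMod q)).re *
          (2 * N - 2 * ∫ x, r (x + Real.log n) * r x)) -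
        (Λ n : ℝ) / Real.sqrt n * (1 + ‖χ (n : ZMod q)‖ ^ 2) * N =
        (Λ n : ℝ) / Real.sqrt n * ((‖1 - conj (χ (n : ZMod q))‖ ^ 2 + 2 * (χ (n : ZMod q)).re -
          (1 + ‖χ (n : ZMod q)‖ ^ 2)) * N) -
        2 * ((Λ n : ℝ) / Real.sqrt n * ((χ (n : ZMod q)).re * ∫ x, r (x + Real.log n) * r x)) := by
      ring
    rw [this, hk]
    ring
  linarith [hsum]

/-! ## The real-window inequality -/

/-- **THE REAL-WINDOW INEQUALITY.**  Let `χ` be a Dirichlet character mod `q ≠ 1`, `a > 0`, and `r : ℝ → ℝ` a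
real window function on `[-a, a]` (measurable, `|r| ≤ S`, `0` off the window, Lipschitz on the closed window)
agreeing on `[-a, a]` with a smooth `f`.  If `WeilPositivityOnChar χ a`, then

  `2Σ_{log n<2a} Λ(n)n^{-1/2} Re χ(n)·∫r(x + log n)r(x)dx + K_κ‖r‖₂² − ∫₀^∞ρ_κ(t)D_t(r)dt ≤ log q · ‖r‖₂²`.

Every real window is a linear inequality on the key `(Re χ(n))_n` with normal vector the sampled
autocorrelation profile; `r = χ_0` is `flatWindow_le_log_of_weilPositivityOnChar`. RH/GRH-free. -/
theorem realWindow_le_log_of_weilPositivityOnChar (hq : q ≠ 1) (χ : DirichletCharacter ℂ q) (ha : 0 < a)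
    (hW : WeilPositivityOnChar χ a) (hm : Measurable r) (hz : ∀ x, x ∉ Icc (-a) a → r x = 0)
    (hb : ∀ x, |r x| ≤ S) {L : ℝ}
    (hL : ∀ x y, x ∈ Icc (-a) a → y ∈ Icc (-a) a → |r y - r x| ≤ L * |y - x|)
    {f : ℝ → ℂ} (hf : ContDiff ℝ ∞ f) (hrf : ∀ x ∈ Icc (-a) a, (r x : ℂ) = f x) :
    2 * (∑ n ∈ weilPrimeIndex a,
          (Λ n : ℝ) / Real.sqrt n * ((χ (n : ZMod q)).re * ∫ x, r (x + Real.log n) * r x)) +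
        (Real.log (4 * π) + Real.eulerMascheroniConstant +
          2 * ∫ t in Ioi (0 : ℝ), weilKillingDensityPar (charParity χ) t) * (∫ x, ‖(r x : ℂ)‖ ^ 2) -
        ∫ t in Ioi (0 : ℝ), weilArchDensityPar (charParity χ) t * weilIncrement (fun x ↦ (r x : ℂ)) t ≤
      Real.log q * ∫ x, ‖(r x : ℂ)‖ ^ 2 := by
  have hwin : IsWindowFunction a (fun x ↦ (r x : ℂ)) := by
    refine ⟨Complex.measurable_ofReal.comp hm, fun x hx ↦ by simp only [hz x hx, Complex.ofReal_zero],
      ⟨S, fun x ↦ by simp only [Complex.norm_real, Real.norm_eq_abs]; exact hb x⟩, ⟨L, fun x y hx hy ↦ ?_⟩⟩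
    simp only [← Complex.ofReal_sub, Complex.norm_real, Real.norm_eq_abs]
    exact hL x y hx hy
  have h := twistedWindowForm_nonneg_of_weilPositivityOnChar hq χ ha hW hwin hf hrf
  rw [twistedWindowForm_ofReal χ hm hz hb] at h
  linarith

/-- **Under `GRH(χ)`** (`χ` primitive mod `q ≠ 1`): the real-window inequality at every window and every real
window function. -/
theorem realWindow_le_log_of_grh [NeZero q] (hq : q ≠ 1) {χ : DirichletCharacter ℂ q}
    (hprim : χ.IsPrimitive) (hGRH : χ.RiemannHypothesis) (ha : 0 < a) (hm : Measurable r)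
    (hz : ∀ x, x ∉ Icc (-a) a → r x = 0) (hb : ∀ x, |r x| ≤ S) {L : ℝ}
    (hL : ∀ x y, x ∈ Icc (-a) a → y ∈ Icc (-a) a → |r y - r x| ≤ L * |y - x|)
    {f : ℝ → ℂ} (hf : ContDiff ℝ ∞ f) (hrf : ∀ x ∈ Icc (-a) a, (r x : ℂ) = f x) :
    2 * (∑ n ∈ weilPrimeIndex a,
          (Λ n : ℝ) / Real.sqrt n * ((χ (n : ZMod q)).re * ∫ x, r (x + Real.log n) * r x)) +
        (Real.log (4 * π) + Real.eulerMascheroniConstant +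
          2 * ∫ t in Ioi (0 : ℝ), weilKillingDensityPar (charParity χ) t) * (∫ x, ‖(r x : ℂ)‖ ^ 2) -
        ∫ t in Ioi (0 : ℝ), weilArchDensityPar (charParity χ) t * weilIncrement (fun x ↦ (r x : ℂ)) t ≤
      Real.log q * ∫ x, ‖(r x : ℂ)‖ ^ 2 :=
  realWindow_le_log_of_weilPositivityOnChar hq χ ha ((WeilPositivityChar.of_grh hq hprim hGRH).on a)
    hm hz hb hL hf hrf

end Summit.Ventures.WeilGRH

end
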